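import Summits.HodgeConjecture.HodgeConjecture.Theorems.SignSymmetricPowersGenDiagonalCoeff
import Summits.HodgeConjecture.HodgeConjecture.Theorems.SignSymmetricPowersMeridianOneNode
import Summits.HodgeConjecture.HodgeConjecture.Theorems.SignSymmetricPowersMeridianChart
import Literature.Analysis.Complex.SmoothHypersurfaceGermTransversal
import Literature.Analysis.Complex.HolomorphicBanach
import HarnessLib

/-!
# K1-B meridian package, G2 part (b): at a form with an exchanged pair of nodes the two branches of the
# discriminant coincide on the invariant linear system (route `SignSymmetricPowers`, item stmt-HodgeConjecture-19716)

Helper file (`--supports stmt-HodgeConjecture-19716`) for the open stubs GEN / LINK-G of the K1-B line `andre-zariski`: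
the PAIR-CENTRE half of the meridian package (memos K1B-GEN-STUBPLAN-g23 H2/H3, K1B-LINKF-PLAN-g23 §3b), which
`SignSymmetricPowersMeridianOneNode` (§2 "one-node centres") leaves open.

Setting: a diagonal `γ` fixing the monomials of `M` (`FixesMonomials`), `Disc` an equation of the discriminant
(`singularCoeffs = V(Disc)`), F-DISC-1 (`discriminant_localBranches_nodal`) GRANTED, and an `M`-supported form `f`
of degree `d` whose singularities are exactly two ordinary double points `q` and `q' = γ • q` exchanged by `γ`
(`γ • q' = q`).  F-DISC-1 gives near `a = coeffsOf f`: `Disc = u · φ₀ · φ₁`, `dφ₀(a) = c₀ ev_q`, `dφ₁(a) = c₁ ev_{q'}`.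

* `pair_localFactorization` — on an open `O ∋ coeff_M f` of the coefficient space `ℂ^M` of `A_M`:
  `D_M(b) = u(b̃) φ₀(b̃) φ₁(b̃)` (`b̃` = extension by zero), `u ≠ 0`, the restricted branch functions
  `ℓᵢ = φᵢ(·̃)` are analytic with `dℓ₀ = c₀ ev_q|_{A_M}`, `dℓ₁ = c₁ ev_{q'}|_{A_M}`, AND **`ℓ₀ b = 0 ↔ ℓ₁ b = 0` on `O`**.
  Proof of the last clause: the diagonal action `z ↦ γ ⋆ z` preserves `singularCoeffs`
  (`SignSymmetricPowersGenDiagonalCoeff`), so near `a` (fixed by the action) `V(φ₀ ∘ γ⋆) ∪ V(φ₁ ∘ γ⋆) = V(φ₀) ∪ V(φ₁)`;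
  the smooth germs `V(φ₀ ∘ γ⋆)` (tangent `ker ev_{q'}`) and `V(φ₀)` (tangent `ker ev_q`) are transversal, so the
  transversal-union lemma (`Literature.Analysis.Complex.exists_nhds_zero_of_zero_subset_union`) gives
  `V(φ₀ ∘ γ⋆) ⊆ V(φ₁)` and symmetrically `V(φ₁) ⊆ V(φ₀ ∘ γ⋆)`; on `A_M` the action is trivial.
The consequences (near `coeff_M f`: `D_M(b) = 0 ↔ ℓ₀(b) = 0`, all partials `∂_k D_M` vanish on that zero set, the
prime factor of `D_M` through `coeff_M f` is unique, has multiplicity two and is transversal to the pencils) are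
drawn in `SignSymmetricPowersGenPairCentre`.

Sorry-free; axioms standard; no definition, no named fact (F-DISC-1 is a hypothesis).

## References

* [VoisinHodgeII2003] C. Voisin, Hodge Theory and Complex Algebraic Geometry II (CUP 2003), §2.1.1 Lemma 2.7,
  Cor. 2.8, pp. 69–70.
* [GriffithsHarris1978] P. Griffiths, J. Harris, Principles of Algebraic Geometry, Ch. 0 §1.
-/

noncomputable section

set_option linter.dupNamespace false

open MvPolynomial
open _root_.Topology
open Literature.AlgebraicGeometry.Motives Literature.AlgebraicGeometry.Motives.UniversalHypersurface
open Literature.AlgebraicGeometry.HodgeTheory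
open Summit.HodgeConjecture.HodgeConjecture.Theorems.SignSymmetricPowersGenDiagonalCoeff
open Summit.HodgeConjecture.HodgeConjecture.Theorems.SignSymmetricPowersMeridianOneNode
open Summit.HodgeConjecture.HodgeConjecture.Theorems.SignSymmetricPowersMeridianChart

namespace Summit.HodgeConjecture.HodgeConjecture.Theorems.SignSymmetricPowersGenPairBranches

variable (n d : ℕ) (M : Set (DegIndex n d)) [DecidablePred (· ∈ M)]

/-! ### §1 Plumbing: extension by zero as a continuous linear map; evaluation functionals are non-zero -/

/-- Extension by zero `ℂ^M → ℂ^{DegIndex}` agrees with the continuous linear map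
`pi (m ↦ if m ∈ M then proj ⟨m, _⟩ else 0)`. [folklore] -/
theorem extCLM_apply (b : M → ℂ) :
    (ContinuousLinearMap.pi fun m : DegIndex n d =>
        if h : m ∈ M then ContinuousLinearMap.proj (R := ℂ) (φ := fun _ : M => ℂ) ⟨m, h⟩ else 0) b =
      fun m : DegIndex n d => if h : m ∈ M then b ⟨m, h⟩ else 0 := by
  funext m
  by_cases hm : m ∈ M
  · simp [dif_pos hm]
  · simp [dif_neg hm]

variable {n d}

/-- The evaluation functional at a non-zero point is non-zero (it does not kill `xᵢ^d` if `xᵢ ≠ 0`).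
[cite: VoisinHodgeII2003, §2.1.1 Cor. 2.8] -/
theorem evalCoeffCLM_ne_zero {x : Fin (n + 2) → ℂ} (hx : x ≠ 0) : evalCoeffCLM n d x ≠ 0 := by
  obtain ⟨i, hi⟩ : ∃ i, x i ≠ 0 := by
    by_contra h
    push Not at h
    exact hx (funext h)
  intro h0
  have h1 := DFunLike.congr_fun h0 (coeffsOf n d (X i ^ d))
  rw [evalCoeffCLM_coeffsOf (isHomogeneous_X_pow i d), zero_apply, map_pow, eval_X] at h1
  exact pow_ne_zero d hi h1

variable (n d)

/-! ### §2 The local factorization at a pair centre, with coinciding branches -/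

/-- **Pair-centre local factorization.**  Let `γ` fix the monomials of `M`, `singularCoeffs = V(Disc)` with `Disc`
irreducible, and GRANT F-DISC-1.  Let `f` be `M`-supported of degree `d ≥ 1` with singular points exactly the two
nodes `q`, `q'` where `q' = γ • q` and `γ • q' = q`, and let `g` be a degree-`d` form with `g(q) ≠ 0`, `g(q') = 0`
(a separating form; it need not be `M`-supported).  Then on an open `O ∋ a := coeff_M f` of `ℂ^M` the restricted
discriminant factors as `D_M(b) = u(b̃) · φ₀(b̃) · φ₁(b̃)` (`b̃` = extension of `b` by zero) with `u ≠ 0` on `O`,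
`φᵢ(·̃)` analytic on `O` and vanishing at `a`, `d(φ₀(·̃))(a) = c₀ · ev_q ∘ ext`, `d(φ₁(·̃))(a) = c₁ · ev_{q'} ∘ ext`
(`cᵢ ≠ 0`), and the two branches COINCIDE on `A_M`: `φ₀(b̃) = 0 ↔ φ₁(b̃) = 0` for `b ∈ O`.
[cite: VoisinHodgeII2003, §2.1.1 Lemma 2.7, Cor. 2.8 and pp. 69–70] -/
theorem pair_localFactorization (hB : discriminant_localBranches_nodal) {Disc : MvPolynomial (DegIndex n d) ℂ}
    (hirr : Irreducible Disc) (hV : ∀ a : DegIndex n d → ℂ, a ∈ singularCoeffs n d ↔ MvPolynomial.eval a Disc = 0)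
    {γ : Fin (n + 2) → ℂˣ} (hγ : FixesMonomials ℂ n d M γ)
    {f : MvPolynomial (Fin (n + 2)) ℂ} (hf : f.IsHomogeneous d) (hMf : IsSupportedOn n d M f)
    {q q' : Fin (n + 2) → ℂ} (hq' : (fun i => (γ i : ℂ) * q i) = q') (hq : (fun i => (γ i : ℂ) * q' i) = q)
    (hnod : IsNodalFormWithNodes f ![q, q'])
    {g : MvPolynomial (Fin (n + 2)) ℂ} (hg : g.IsHomogeneous d) (hgq : MvPolynomial.eval q g ≠ 0)
    (hgq' : MvPolynomial.eval q' g = 0) :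
    ∃ (O : Set (M → ℂ)) (φ₀ φ₁ u : (DegIndex n d → ℂ) → ℂ) (c₀ c₁ : ℂ),
      IsOpen O ∧ (fun m' : M => coeff m'.1.1 f) ∈ O ∧ c₀ ≠ 0 ∧ c₁ ≠ 0 ∧
      AnalyticOnNhd ℂ (fun b : M → ℂ => φ₀ (fun m => if h : m ∈ M then b ⟨m, h⟩ else 0)) O ∧
      AnalyticOnNhd ℂ (fun b : M → ℂ => φ₁ (fun m => if h : m ∈ M then b ⟨m, h⟩ else 0)) O ∧
      AnalyticOnNhd ℂ (fun b : M → ℂ => u (fun m => if h : m ∈ M then b ⟨m, h⟩ else 0)) O ∧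
      φ₀ (coeffsOf n d f) = 0 ∧ φ₁ (coeffsOf n d f) = 0 ∧
      HasFDerivAt (fun b : M → ℂ => φ₀ (fun m => if h : m ∈ M then b ⟨m, h⟩ else 0))
        ((c₀ • evalCoeffCLM n d q).comp (ContinuousLinearMap.pi fun m : DegIndex n d =>
          if h : m ∈ M then ContinuousLinearMap.proj (R := ℂ) (φ := fun _ : M => ℂ) ⟨m, h⟩ else 0))
        (fun m' : M => coeff m'.1.1 f) ∧
      HasFDerivAt (fun b : M → ℂ => φ₁ (fun m => if h : m ∈ M then b ⟨m, h⟩ else 0))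
        ((c₁ • evalCoeffCLM n d q').comp (ContinuousLinearMap.pi fun m : DegIndex n d =>
          if h : m ∈ M then ContinuousLinearMap.proj (R := ℂ) (φ := fun _ : M => ℂ) ⟨m, h⟩ else 0))
        (fun m' : M => coeff m'.1.1 f) ∧
      (∀ b ∈ O, u (fun m => if h : m ∈ M then b ⟨m, h⟩ else 0) ≠ 0) ∧
      (∀ b ∈ O, MvPolynomial.eval b (killHom ℂ n d M Disc) =
        u (fun m => if h : m ∈ M then b ⟨m, h⟩ else 0) *
          φ₀ (fun m => if h : m ∈ M then b ⟨m, h⟩ else 0) * φ₁ (fun m => if h : m ∈ M then b ⟨m, h⟩ else 0)) ∧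
      (∀ b ∈ O, φ₀ (fun m => if h : m ∈ M then b ⟨m, h⟩ else 0) = 0 ↔
        φ₁ (fun m => if h : m ∈ M then b ⟨m, h⟩ else 0) = 0) := by
  classical
  -- F-DISC-1 at `f`
  obtain ⟨W, hW, haW, φ, u, c, hφ, hu, hu0, hfac⟩ := hB n d 2 Disc hirr hV f hf ![q, q'] hnod
  obtain ⟨hφd0, hφ00, hc0, hφder0⟩ := hφ 0
  obtain ⟨hφd1, hφ10, hc1, hφder1⟩ := hφ 1
  simp only [Matrix.cons_val_zero, Matrix.cons_val_one] at hφder0 hφder1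
  -- notation
  set a : DegIndex n d → ℂ := coeffsOf n d f with ha_def
  let T : (DegIndex n d → ℂ) →L[ℂ] (DegIndex n d → ℂ) :=
    ContinuousLinearMap.pi fun m : DegIndex n d =>
      (unitWeight ℂ n γ m.1 : ℂ) • ContinuousLinearMap.proj (R := ℂ) (φ := fun _ : DegIndex n d => ℂ) m
  have hT : ∀ z, T z = (fun m : DegIndex n d => (unitWeight ℂ n γ m.1 : ℂ)) * z := fun z => weightCLM_apply γ z
  let ext : (M → ℂ) → (DegIndex n d → ℂ) := fun b m => if h : m ∈ M then b ⟨m, h⟩ else 0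
  have hext_def : ∀ b, ext b = fun m => if h : m ∈ M then b ⟨m, h⟩ else 0 := fun b => rfl
  let extL : (M → ℂ) →L[ℂ] (DegIndex n d → ℂ) := ContinuousLinearMap.pi fun m : DegIndex n d =>
    if h : m ∈ M then ContinuousLinearMap.proj (R := ℂ) (φ := fun _ : M => ℂ) ⟨m, h⟩ else 0
  have hextL : ∀ b, extL b = ext b := fun b => extCLM_apply n d M b
  have hext_cont : Continuous ext := continuous_extendByZero n d M
  have hext_an : ∀ b, AnalyticAt ℂ ext b := fun b =>
    (extL.analyticAt b).congr (Filter.Eventually.of_forall fun b' => hextL b')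
  have ha_ext : ext (fun m' : M => coeff m'.1.1 f) = a := extend_coeffM_eq_coeffsOf n d M hMf
  have hText : ∀ b, T (ext b) = ext b := fun b => by
    rw [hT, hext_def]; exact weight_mul_extend_eq n d M hγ b
  have hTa : T a = a := by rw [← ha_ext]; exact hText (fun m' : M => coeff m'.1.1 f)
  -- analyticity of the branch functions (Osgood)
  have hφan0 : AnalyticOnNhd ℂ (φ 0) W :=
    Literature.Analysis.Complex.HolomorphicBanach.analyticOnNhd_of_differentiableOn hφd0 hW
  have hφan1 : AnalyticOnNhd ℂ (φ 1) W :=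
    Literature.Analysis.Complex.HolomorphicBanach.analyticOnNhd_of_differentiableOn hφd1 hW
  have huan : AnalyticOnNhd ℂ u W :=
    Literature.Analysis.Complex.HolomorphicBanach.analyticOnNhd_of_differentiableOn hu hW
  -- the open set `S = W ∩ T⁻¹ W ∋ a`
  set S : Set (DegIndex n d → ℂ) := W ∩ T ⁻¹' W with hS_def
  have hS : IsOpen S := hW.inter (hW.preimage T.continuous)
  have haS : a ∈ S := ⟨haW, by change T a ∈ W; rw [hTa]; exact haW⟩
  -- the separating vector
  set v : DegIndex n d → ℂ := coeffsOf n d g with hv_def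
  have hvq : evalCoeffCLM n d q v = MvPolynomial.eval q g := evalCoeffCLM_coeffsOf hg q
  have hvq' : evalCoeffCLM n d q' v = 0 := by rw [hv_def, evalCoeffCLM_coeffsOf hg q']; exact hgq'
  -- evaluation functionals after the action
  have hevT : ∀ x : Fin (n + 2) → ℂ, (evalCoeffCLM n d x).comp T = evalCoeffCLM n d (fun i => (γ i : ℂ) * x i) := by
    intro x; ext z
    rw [ContinuousLinearMap.comp_apply, hT, evalCoeffCLM_weight_mul]
  -- derivatives of `φ i ∘ T` at `a`
  have hderT0 : HasFDerivAt (fun z => φ 0 (T z)) (c 0 • evalCoeffCLM n d q') a := by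
    have h1 : HasFDerivAt (φ 0) (c 0 • evalCoeffCLM n d q) (T a) := by rw [hTa]; exact hφder0
    have h2 := h1.comp a T.hasFDerivAt
    rwa [ContinuousLinearMap.smul_comp, hevT, hq'] at h2
  have hderT1 : HasFDerivAt (fun z => φ 1 (T z)) (c 1 • evalCoeffCLM n d q) a := by
    have h1 : HasFDerivAt (φ 1) (c 1 • evalCoeffCLM n d q') (T a) := by rw [hTa]; exact hφder1
    have h2 := h1.comp a T.hasFDerivAt
    rwa [ContinuousLinearMap.smul_comp, hevT, hq] at h2
  -- analyticity of the compositions on `S`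
  have hanT0 : AnalyticOnNhd ℂ (fun z => φ 0 (T z)) S := fun z hz =>
    (hφan0 (T z) hz.2).comp (T.analyticAt z)
  have hanT1 : AnalyticOnNhd ℂ (fun z => φ 1 (T z)) S := fun z hz =>
    (hφan1 (T z) hz.2).comp (T.analyticAt z)
  -- the set-theoretic cover: `φ 0 (T z) = 0 → φ 0 z = 0 ∨ φ 1 z = 0`, and `φ 1 z = 0 → …`
  have hsing : ∀ z ∈ W, (z ∈ singularCoeffs n d ↔ ∃ i, φ i z = 0) := by
    intro z hz
    rw [hV, hfac z hz, mul_eq_zero, Finset.prod_eq_zero_iff]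
    simp only [hu0 z hz, false_or, Finset.mem_univ, true_and]
  have hq'0 : q' ≠ 0 := (hnod.1 1).ne_zero
  have hq0 : q ≠ 0 := (hnod.1 0).ne_zero
  have hcover1 : ∀ z ∈ S, φ 0 (T z) = 0 → φ 0 z = 0 ∨ φ 1 z = 0 := by
    intro z hz h0
    have hTz : T z ∈ singularCoeffs n d := (hsing (T z) hz.2).2 ⟨0, h0⟩
    rw [hT, weight_mul_mem_singularCoeffs_iff] at hTz
    obtain ⟨i, hi⟩ := (hsing z hz.1).1 hTz
    fin_cases i
    · exact Or.inl hi
    · exact Or.inr hi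
  have hcover2 : ∀ z ∈ S, φ 1 z = 0 → φ 1 (T z) = 0 ∨ φ 0 (T z) = 0 := by
    intro z hz h1
    have hz' : z ∈ singularCoeffs n d := (hsing z hz.1).2 ⟨1, h1⟩
    rw [← weight_mul_mem_singularCoeffs_iff γ, ← hT] at hz'
    obtain ⟨i, hi⟩ := (hsing (T z) hz.2).1 hz'
    fin_cases i
    · exact Or.inr hi
    · exact Or.inl hi
  -- transversal-union, twice
  have e10 : fderiv ℂ (fun z => φ 0 (T z)) a v = 0 := by
    rw [hderT0.fderiv]; simp [hvq']
  have e1β : fderiv ℂ (φ 0) a v ≠ 0 := by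
    rw [hφder0.fderiv]; simpa [hvq] using mul_ne_zero hc0 hgq
  have e20 : fderiv ℂ (φ 1) a v = 0 := by
    rw [hφder1.fderiv]; simp [hvq']
  have e2β : fderiv ℂ (fun z => φ 1 (T z)) a v ≠ 0 := by
    rw [hderT1.fderiv]; simpa [hvq] using mul_ne_zero hc1 hgq
  obtain ⟨S₁, hS₁, haS₁, hS₁S, himp1⟩ :=
    Literature.Analysis.Complex.exists_nhds_zero_of_zero_subset_union (ι := DegIndex n d)
      (α := fun z => φ 0 (T z)) (β := φ 0) (γ := φ 1) hS haS hanT0 (hφan0.mono fun z hz => hz.1)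
      (hφd1.continuousOn.mono fun z hz => hz.1) (by rw [hTa]; exact hφ00)
      (by rw [hderT0.fderiv]; exact smul_ne_zero hc0 (evalCoeffCLM_ne_zero hq'0))
      ⟨v, e10, e1β⟩ hcover1
  obtain ⟨S₂, hS₂, haS₂, hS₂S, himp2⟩ :=
    Literature.Analysis.Complex.exists_nhds_zero_of_zero_subset_union (ι := DegIndex n d)
      (α := φ 1) (β := fun z => φ 1 (T z)) (γ := fun z => φ 0 (T z)) hS haS
      (hφan1.mono fun z hz => hz.1) hanT1 (hanT0.continuousOn) hφ10
      (by rw [hφder1.fderiv]; exact smul_ne_zero hc1 (evalCoeffCLM_ne_zero hq'0))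
      ⟨v, e20, e2β⟩ hcover2
  -- the open set on `A_M`
  refine ⟨ext ⁻¹' (S₁ ∩ S₂), φ 0, φ 1, u, c 0, c 1, (hS₁.inter hS₂).preimage hext_cont, ?_, hc0, hc1,
    ?_, ?_, ?_, hφ00, hφ10, ?_, ?_, ?_, ?_, ?_⟩
  · show ext (fun m' : M => coeff m'.1.1 f) ∈ S₁ ∩ S₂
    rw [ha_ext]; exact ⟨haS₁, haS₂⟩
  · intro b hb
    exact (hφan0 (ext b) (hS₁S hb.1).1).comp (hext_an b)
  · intro b hb
    exact (hφan1 (ext b) (hS₁S hb.1).1).comp (hext_an b)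
  · intro b hb
    exact (huan (ext b) (hS₁S hb.1).1).comp (hext_an b)
  · have h1 : HasFDerivAt (φ 0) (c 0 • evalCoeffCLM n d q) (extL (fun m' : M => coeff m'.1.1 f)) := by
      rw [hextL, ha_ext]; exact hφder0
    have h2 := h1.comp _ extL.hasFDerivAt
    exact h2.congr_of_eventuallyEq (Filter.Eventually.of_forall fun b => by
      show φ 0 (ext b) = φ 0 (extL b); rw [hextL])
  · have h1 : HasFDerivAt (φ 1) (c 1 • evalCoeffCLM n d q') (extL (fun m' : M => coeff m'.1.1 f)) := by
      rw [hextL, ha_ext]; exact hφder1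
    have h2 := h1.comp _ extL.hasFDerivAt
    exact h2.congr_of_eventuallyEq (Filter.Eventually.of_forall fun b => by
      show φ 1 (ext b) = φ 1 (extL b); rw [hextL])
  · intro b hb
    exact hu0 _ (hS₁S hb.1).1
  · intro b hb
    rw [eval_killHom, hfac _ (hS₁S hb.1).1, Fin.prod_univ_two, mul_assoc]
  · intro b hb
    constructor
    · intro h0
      have : φ 0 (T (ext b)) = 0 := by rw [hText]; exact h0
      exact himp1 (ext b) hb.1 this
    · intro h1
      have := himp2 (ext b) hb.2 h1
      rwa [hText] at this

end Summit.HodgeConjecture.HodgeConjecture.Theorems.SignSymmetricPowersGenPairBranches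

end
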